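import Summits.KontsevichZagierPeriods.KontsevichZagierPeriods.Theses.GenusOneIterated
import Summits.KontsevichZagierPeriods.KontsevichZagierPeriods.Theorems.InverseLandauTateLiftingKummerLogTwo

/-!
# `KummerLogTwo` (stmt-KontsevichZagierPeriods-6778, route GenusOneIterated) — proof

Kummer's `log 2` on the lemniscatic curve `y² = 4x³ − 4x` inside the Kontsevich–Zagier move
calculus: every two-dimensional representation with domain the open triangle `{−1 < x₀ < x₁ < 0}`
and integrand `(x₁ − x₀)/(√(4x₀³ − 4x₀) √(4x₁³ − 4x₁))` on it is `KZ.Equivalent` to every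
one-dimensional representation with domain `(1, 2)` and integrand `1/(2u)` on it (value
`½ log 2`). It is verbatim `Summit.KontsevichZagierPeriods.InverseLandau.tateLifting_kummerLogTwo`
(`Theorems/InverseLandauTateLiftingKummerLogTwo.lean`, stub of the line `Sketch` of the crux
`TateLifting`, stmt-KontsevichZagierPeriods-9129, lead c10), itself the specialisation of the
general-modulus certificate `GenusOneIterated.KummerFamily.equivalent` at `(e₁, e₂, e₃) = (1, 0, −1)`.
-/

namespace Summit.KontsevichZagierPeriods.GenusOneIterated

/-- **`KummerLogTwo`** (route GenusOneIterated, stmt-KontsevichZagierPeriods-6778): a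
representation `[{−1 < x₀ < x₁ < 0}, (x₁ − x₀)/(√(4x₀³−4x₀)√(4x₁³−4x₁))]` is `KZ.Equivalent` to a
representation `[(1, 2), 1/(2u)]`. Proof: `InverseLandau.tateLifting_kummerLogTwo`.
[cite: KontsevichZagier2001, §1.2] -/
theorem kummerLogTwo_proof :
    Summit.KontsevichZagierPeriods.KontsevichZagierPeriods.Theses.GenusOneIterated.KummerLogTwo :=
  Summit.KontsevichZagierPeriods.InverseLandau.tateLifting_kummerLogTwo

end Summit.KontsevichZagierPeriods.GenusOneIterated
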